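import Literature.Analysis.FluidPDE.FluidComputer.ReachCertificate
import Literature.Analysis.ODE.MaximalTime
import HarnessLib

/-!
# Fluid computer blueprint — the continuation principle for stage certificates

HONEST FRAMING: low prior, high value-of-information experiment on Tao's machine paradigm; NOT a
claim that NS blows up. Everything in this file is elementary bookkeeping about the reach layer's
interface `ReachCertificate` (`ReachCertificate.lean`); nothing is asserted about any fluid
equation, and nothing about any particular gate.

## Why

`ReachCertificate.comp` (`CertificateComposition.lean`) composes two stage certificates for the
SAME working region `U`. The stages of a gate cycle are naturally certified over DIFFERENT regions
(the threshold gate: pre-threshold and crossing stages over the loaded region `{a > a₀, |Xᵢ| < R}`,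
whose membership hands the carrier bound to the stage's estimates for free; the ignition–transfer
stage necessarily over the bare energy ball `{|Xᵢ| < R}`, since the rotor drains the carrier). This
file proves that the difference is immaterial when the smaller region is OPEN:

* `ReachCertificate.mem_tube` — **the continuation principle.** For a certificate over an open
  working region `U`, EVERY continuous curve from `p ∈ Ain` with an `ε`-admissible right derivative
  on `[0, σT)`, `σT ≤ τc`, lies in the tube `Tube p σ` for all `σ ∈ [0, σT]` — with NO a-priori
  hypothesis that the curve stays in `U`: the tube lies in `U`, `U` is open, and the maximal time up
  to which the curve is in the tube (`ODE/MaximalTime.lean`) cannot be `< σT` by the certificate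
  applied on slightly longer windows (exit principle `not_eventually_of_maximalTimeP_lt`; closedness
  of the tube's graph makes the condition closed under left limits).
* `ReachCertificate.enlarge` — hence a certificate over an open `U` IS a certificate over any
  `U' ⊇ U` (same tube, same regions `Ain`, `Aout`), in particular over the energy ball or `univ`.

So stage certificates may each be proved over the region that makes their estimates cheapest and
then be moved to a common region before `comp`.
[cite: Tao2016AveragedNS, §5.5 (the three phases of Thm 5.3); §1.3 pp. 10–11]
-/

noncomputable section

open Set Filter Topology
open scoped NNReal

namespace Literature.Analysis.FluidPDE.FluidComputer

open Literature.Analysis.ODE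

variable {O : Type*} [NormedAddCommGroup O] [NormedSpace ℝ O]

namespace ReachCertificate

variable {F : O → O} {U : Set O} {ε τc : ℝ} {Ain Aout : Set O}

/-- **The continuation principle.** For a certificate over an OPEN working region, every continuous
curve from `p ∈ Ain` with `ε`-admissible right derivative on `[0, σT)`, `0 ≤ σT ≤ τc`, lies in the
tube at every time of `[0, σT]` — no hypothesis that the curve stays in `U` is needed.
[folklore] -/
theorem mem_tube (C : ReachCertificate F U ε τc Ain Aout) (hUo : IsOpen U) {p : O} (hp : p ∈ Ain)
    {σT : ℝ} {x : ℝ → O} (h0 : 0 ≤ σT) (hσT : σT ≤ τc) (hx0 : x 0 = p)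
    (hcont : ContinuousOn x (Icc 0 σT))
    (hW : ∀ σ ∈ Ico 0 σT, ∃ W : O, HasDerivWithinAt x W (Ici σ) σ ∧ ‖W - F (x σ)‖ ≤ ε) :
    ∀ σ ∈ Icc 0 σT, x σ ∈ C.Tube p σ := by
  set P : ℝ → Prop := fun s => x s ∈ C.Tube p s with hP_def
  have hP0 : P 0 := by
    show x 0 ∈ C.Tube p 0
    rw [hx0]; exact C.Tube_zero p hp
  -- the condition is closed under limits from the left (closed graph + continuity)
  have hclosed : ∀ t ∈ Ioc 0 σT, (∀ s ∈ Ico 0 t, P s) → P t := by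
    intro t ht hPs
    have hG := C.Tube_closed p hp
    have hx : ContinuousWithinAt x (Ico 0 t) t :=
      (hcont t ⟨ht.1.le, ht.2⟩).mono fun s hs => ⟨hs.1, hs.2.le.trans ht.2⟩
    have hφ : ContinuousWithinAt (fun s => (s, x s)) (Ico 0 t) t :=
      continuousWithinAt_id.prodMk hx
    have hmem : t ∈ closure (Ico 0 t) := by
      rw [closure_Ico ht.1.ne]; exact right_mem_Icc.2 ht.1.le
    have himg := hφ.mem_closure_image hmem
    have hsub : (fun s => (s, x s)) '' Ico 0 t ⊆
        {z : ℝ × O | z.1 ∈ Icc 0 τc ∧ z.2 ∈ C.Tube p z.1} := by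
      rintro _ ⟨s, hs, rfl⟩
      exact ⟨⟨hs.1, (hs.2.le.trans ht.2).trans hσT⟩, hPs s hs⟩
    exact (hG.closure_subset_iff.2 hsub himg).2
  set t₁ := maximalTimeP P 0 σT with ht₁_def
  have ht₁ : t₁ ∈ Icc 0 σT := maximalTimeP_mem h0 hP0
  have hspec : ∀ s ∈ Icc 0 t₁, P s := fun s hs => maximalTimeP_spec h0 hP0 hclosed hs
  suffices hEq : t₁ = σT by
    intro σ hσ
    exact hspec σ ⟨hσ.1, hEq ▸ hσ.2⟩
  by_contra hne
  have hlt : t₁ < σT := lt_of_le_of_ne ht₁.2 hne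
  apply not_eventually_of_maximalTimeP_lt h0 hP0 hlt
  -- the curve is in the open region `U` near `t₁`, so the certificate applies slightly beyond `t₁`
  have hxU : x t₁ ∈ U := C.Tube_sub p hp t₁ ⟨ht₁.1, ht₁.2.trans hσT⟩ (hspec t₁ ⟨ht₁.1, le_rfl⟩)
  have hev : ∀ᶠ t in 𝓝[Icc 0 σT] t₁, x t ∈ U :=
    (hcont t₁ ht₁).preimage_mem_nhdsWithin (hUo.mem_nhds hxU)
  rw [eventually_nhdsWithin_iff, Metric.eventually_nhds_iff] at hev ⊢
  obtain ⟨η, hη, hηU⟩ := hev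
  refine ⟨η, hη, fun t hdist htI => ?_⟩
  rcases le_or_gt t t₁ with hle | hgt
  · exact hspec t ⟨htI.1, hle⟩
  · have hUt : ∀ σ ∈ Ico 0 t, x σ ∈ U := by
      intro σ hσ
      rcases le_or_gt σ t₁ with h1 | h1
      · exact C.Tube_sub p hp σ ⟨hσ.1, h1.trans (ht₁.2.trans hσT)⟩ (hspec σ ⟨hσ.1, h1⟩)
      · refine hηU ?_ ⟨hσ.1, hσ.2.le.trans htI.2⟩
        rw [Real.dist_eq, abs_of_pos (by linarith)] at hdist ⊢
        linarith [hσ.2]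
    exact (C.cert p hp t x htI.1 (htI.2.trans hσT) hx0
      (hcont.mono (Icc_subset_Icc_right htI.2)) hUt
      (fun σ hσ => hW σ ⟨hσ.1, lt_of_lt_of_le hσ.2 htI.2⟩)).1

/-- **REACH without the region hypothesis**: over an open working region, every admissible curve
from `p ∈ Ain` on the full cycle `[0, τc]` passes through `Aout`. [folklore] -/
theorem reach (C : ReachCertificate F U ε τc Ain Aout) (hUo : IsOpen U) {p : O} (hp : p ∈ Ain)
    {x : ℝ → O} (hτ : 0 ≤ τc) (hx0 : x 0 = p) (hcont : ContinuousOn x (Icc 0 τc))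
    (hW : ∀ σ ∈ Ico 0 τc, ∃ W : O, HasDerivWithinAt x W (Ici σ) σ ∧ ‖W - F (x σ)‖ ≤ ε) :
    ∃ σ ∈ Icc 0 τc, x σ ∈ Aout := by
  have hmem := C.mem_tube hUo hp hτ le_rfl hx0 hcont hW
  have hU : ∀ σ ∈ Ico 0 τc, x σ ∈ U :=
    fun σ hσ => C.Tube_sub p hp σ (Ico_subset_Icc_self hσ) (hmem σ (Ico_subset_Icc_self hσ))
  exact (C.cert p hp τc x hτ le_rfl hx0 hcont hU hW).2 rfl

/-- **Enlarging the working region.** A certificate over an OPEN working region `U` is a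
certificate over any `U' ⊇ U`: same tube, same input and output regions. (`cert` for `U'` ignores
its region hypothesis and uses the continuation principle `mem_tube` instead.) [folklore] -/
def enlarge (C : ReachCertificate F U ε τc Ain Aout) (hUo : IsOpen U) {U' : Set O}
    (hUU' : U ⊆ U') : ReachCertificate F U' ε τc Ain Aout where
  Tube := C.Tube
  Tube_closed := C.Tube_closed
  Tube_zero := C.Tube_zero
  Tube_sub p hp σ hσ := (C.Tube_sub p hp σ hσ).trans hUU'
  cert p hp σT x h0 hσT hx0 hcont _ hW := by
    have hmem := C.mem_tube hUo hp h0 hσT hx0 hcont hW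
    have hU : ∀ σ ∈ Ico 0 σT, x σ ∈ U := fun σ hσ =>
      C.Tube_sub p hp σ ⟨hσ.1, hσ.2.le.trans hσT⟩ (hmem σ (Ico_subset_Icc_self hσ))
    exact C.cert p hp σT x h0 hσT hx0 hcont hU hW

/-- Same tube after enlarging the working region. [folklore] -/
theorem enlarge_tube (C : ReachCertificate F U ε τc Ain Aout) (hUo : IsOpen U) {U' : Set O}
    (hUU' : U ⊆ U') (p : O) (σ : ℝ) : (C.enlarge hUo hUU').Tube p σ = C.Tube p σ := rfl

end ReachCertificate

end Literature.Analysis.FluidPDE.FluidComputer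

end
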